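import Summits.HodgeConjecture.HodgeConjecture.Theorems.SixfoldTableXCover
import Summits.HodgeConjecture.HodgeConjecture.Theorems.SixfoldTableXRow25NonAligned
import HarnessLib

/-!
# TABLE X (dimension 6) — the cover with the K3-partner residue NARROWED INTRINSICALLY: HC is demanded only on the
# DEGENERATE members of the K3P cell (`B•(Aⁿ) ≠ D•` for some `n`), and the non-aligned row-25 members are certified
# OUTSIDE that class (cell `pub-hodgeav-hg6`, req-37 (A) Q2b; eng-2 g7, director-hodge g19 ack25 ∕ ack29, brick R25-5)

HONEST FRAMING. HC, `HC_AV` (stmt-1333), `HC_CM` (`Theses.RankFourFaces.CMAbelianHodge`, stmt-3052) and the rung H2 are NOT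
proved; they and the residues occur only as HYPOTHESES BY NAME. The census nodes `SixfoldCodimTwoCensus` / `SixfoldCodimThreeCensus`
are OURS (`@[conjecture]`), never asserted. KERNEL ONLY: theorems over existing declarations; no definition, no `sorry`, no new
named fact. NOTHING landed is edited: this is a NEW cover variant beside `SixfoldTableXCover` (v3) and `SixfoldTableXOffResidue`.

WHAT THIS MODULE ADDS (a RESHAPED RESIDUE LIST, not an HC statement). The landed covers carry the K3-partner residue as the
binder `hK3P : Ring2.Atlas.HodgeQuarticTypeIVFourfoldTimesCMSurface` = HC on the WHOLE cell
`ProdCMCell IsQuarticFieldTypeIVFourfold (dim = 2)` («`A ∼ Y × Z`, `Y` a simple quartic-field type-IV fourfold, `Z` ANY CM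
surface» — no alignment condition), although the cell's exceptional classes live only on its ALIGNED members (the K3 partners,
TABLE X rows 23 ∕ 24) and its Weil members (rows 26 ∕ 27); TABLE X row 25 (the non-aligned configurations) has `B = D`
(engines: J3 ∕ J4 ∕ J6 control rows; kernel: `TableX.ProductRows.isStablyNondegenerate_row25_of_notAligned`, p704252, over
`HodgeTheory/QuarticCentreTimesSimpleCMSurfaceProductSpan` p703657 and the Lie step p702462). Here the binder is narrowed
INTRINSICALLY — by the property that makes a member exceptional, not by a list:

  **`hK3Pdeg : HCOnClass fun A ↦ ProdCMCell IsQuarticFieldTypeIVFourfold (dim = 2) A ∧ ¬ IsStablyNondegenerate A`**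

(HC demanded only where `B•(Aⁿ) ≠ D•(Aⁿ)` for some `n`). §1: for ANY class, HC on its degenerate part gives HC on the class
(`hcOnClass_of_hcOnClass_and_not_isStablyNondegenerate`: stably nondegenerate members satisfy HC by `B = D` + Lefschetz `(1,1)`,
`IsStablyNondegenerate.hodgeConjectureFor`), so `hK3Pdeg ⟹ hK3P` (`hodgeQuarticTypeIVFourfoldTimesCMSurface_of_degenerate`). §2:
the covers **`hcAtDim_six_of_tableX_k3pDegenerate`** and **`hcAtDim_six_of_tableX_cmSplit_k3pDegenerate`** = the landed
`hcAtDim_six_of_tableX_residues` ∕ `_cmSplit` with `hK3P` replaced by `hK3Pdeg`, every other binder VERBATIM. §3: the kernel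
certificates that TABLE X row 25 has LEFT the residue — **`not_k3pDegenerate_of_row25_notAligned`** (every `A ∼ S × Y` with `Y`
in R10's class, `S` a simple CM surface of type `(K, Φ)` and the member datum hNA is OUTSIDE the narrowed class) and
`not_k3pDegenerate_of_row25_sameField` (row 25a, no datum); v2: `not_k3pDegenerate_of_row25_biquadraticCentre` (`E` biquadratic,
member data `h4μ`, `hbq`, no datum — over eng-4 g9's `QuarticCMTraceFieldNoImaginaryQuadratic`).

READING (three-clause form). (i) KERNEL: the dimension-6 cover holds with R-K3P := {`A` in the K3P cell : `B•(Aⁿ) ≠ D•` for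
some `n`} in place of the whole cell, and the non-aligned row-25 members (simple `S`; `Y` of signature `{(2,0),(1,1)}`; hNA,
or samefield without datum) are certified outside it — unconditional, std axioms; (ii) modulo the SAME displayed binders as the
landed cover otherwise (Markman₄; Markman₆ UNREFEREED; `HC_CM` resp. the CM-splitness `hS` + HC for non-simple CM sixfolds;
R-W6 = `WeilTypeLadder.NonsplitSixfolds`; X2, X1); (iii) NOT proved ∕ not certified: WHICH further members lie outside the
degenerate class — by the cell's engines the degenerate locus of the K3P cell is exactly {aligned K3 partners, rows 23 ∕ 24} ∪
{Weil members, rows 26 ∕ 27}, but the kernel so far certifies only the simple-`S`, signature-`{(2,0),(1,1)}` non-aligned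
complement; the non-simple-`Z` non-Weil members (`Y × E′ × E″`, tree tools `CentreTimesCMCurveNoEmbedding`,
`QuarticCMTimesCMCurveProductSpan`) and the quartic fourfolds of signature `{(1,1),(1,1)}` times `Z` (Θ-trace condition,
`ThetaTraceTimesCMProductSpan`) are the successor brick R25-6; HC ∕ `HC_AV` ∕ `HC_CM` ∕ H2. Row 25 lies INSIDE `𝒞` and carries
no census node; nothing here is a census move. Nothing here is a corollary of `HC_CM`; typed ≠ proved.
-/

set_option linter.dupNamespace false

noncomputable section

open CategoryTheory NumberField
open Literature.AlgebraicGeometry Literature.AlgebraicGeometry.Motives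
open Literature.AlgebraicGeometry.Motives.AbelianVariety (IsIsogenous)
open Literature.AlgebraicGeometry.HodgeTheory
open Literature.AlgebraicGeometry.ComplexMultiplication
open Literature.AlgebraicGeometry.Milne1999
open Literature.AlgebraicTopology.SingularHomology
open Literature.Barriers.HodgeConjecture
open Literature.NumberTheory.ComplexMultiplication
open Summit.HodgeConjecture.HodgeConjecture.Ring2.ClassTargets
open Summit.HodgeConjecture.HodgeConjecture.Ring2.Motiv (ProdCMCell)
open Summit.HodgeConjecture.HodgeConjecture.Ring2.Atlas (IsQuarticFieldTypeIVFourfold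
  HodgeQuarticTypeIVFourfoldTimesCMSurface IsSimpleCMSixfold)
open Summit.HodgeConjecture.HodgeConjecture.Ring2.Hypotheses (splitDiscriminantClass)
open Literature.AlgebraicGeometry.VanGeemen1994 (HasWeilDiscriminantNondeg)

namespace Summit.HodgeConjecture.HodgeConjecture.TableX

/-! ## §1 HC on the degenerate part of a class gives HC on the class -/

/-- **HC on a class follows from HC on its DEGENERATE part** (the members with `B•(Aⁿ) ≠ D•(Aⁿ)` for some `n`): a stably
nondegenerate member satisfies the Hodge conjecture by `B = D` and Lefschetz `(1,1)` (`IsStablyNondegenerate.hodgeConjectureFor`,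
van Geemen §2.4). [cite: vanGeemen1994HodgeAV, §2.4] [cite: Gordon1999HodgeAVSurvey, Thm. 7.5 and Def. 7.6] -/
theorem hcOnClass_of_hcOnClass_and_not_isStablyNondegenerate {𝒞 : AbelianVariety ℂ → Prop}
    (h : HCOnClass fun A ↦ 𝒞 A ∧ ¬ IsStablyNondegenerate A) : HCOnClass 𝒞 := by
  intro A hA
  by_cases hD : IsStablyNondegenerate A
  · exact hD.hodgeConjectureFor
  · exact h A ⟨hA, hD⟩

/-- Conversely HC on a class gives HC on its degenerate part (so the two binders are EQUIVALENT as hypotheses; the narrowed one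
says where the content is). [folklore] -/
theorem hcOnClass_and_not_isStablyNondegenerate_of_hcOnClass {𝒞 : AbelianVariety ℂ → Prop} (h : HCOnClass 𝒞) :
    HCOnClass fun A ↦ 𝒞 A ∧ ¬ IsStablyNondegenerate A :=
  hcOnClass_mono (fun _ hA ↦ hA.1) h

/-- **The K3-partner binder from its degenerate part**: HC on the members of the K3P cell with `B ≠ D` on some power gives
`Ring2.Atlas.HodgeQuarticTypeIVFourfoldTimesCMSurface` (HC on the whole cell). [cite: vanGeemen1994HodgeAV, §2.4]
[cite: MoonenZarhin1999LowDim, §5 Case 2] -/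
theorem hodgeQuarticTypeIVFourfoldTimesCMSurface_of_degenerate
    (hK3Pdeg : HCOnClass fun A ↦
      ProdCMCell IsQuarticFieldTypeIVFourfold (fun Z ↦ Z.dim = 2) A ∧ ¬ IsStablyNondegenerate A) :
    HodgeQuarticTypeIVFourfoldTimesCMSurface :=
  hcOnClass_of_hcOnClass_and_not_isStablyNondegenerate hK3Pdeg

/-! ## §2 The covers with the K3P binder narrowed to the degenerate members -/

/-- **TABLE X COVER, RESIDUES NAMED, K3P NARROWED (dimension 6).** GRANTED the two Markman facts (fourfolds; hyperbolic sixfolds,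
UNREFEREED), the binder `HC_CM`, HC on the DEGENERATE members of the K3-partner cell only (R-K3P := {`A ∼ Y × Z` in the cell :
`B•(Aⁿ) ≠ D•` for some `n`}), R-W6 = `WeilTypeLadder.NonsplitSixfolds`, and the two dimension-6 census nodes (OURS), the Hodge
conjecture holds for every complex abelian variety of dimension `6` — the landed `hcAtDim_six_of_tableX_residues` with `hK3P`
replaced by `hK3Pdeg`. None of the hypotheses is asserted. [cite: MoonenZarhin1999LowDim, Thms. 0.1–0.2, §5]
[cite: Markman2025SecantWeil, Thm. 1.5.1 (preprint, unrefereed)] [claim: Markman2025SurveySecant, status: under-review]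
[cite: vanGeemen1994HodgeAV, §2.4 and (5.4.1)] -/
theorem hcAtDim_six_of_tableX_k3pDegenerate (hMark₄ : Markman2025_weilClasses_algebraic_abelianFourfold)
    (hMark₆ : Markman2025_weilClasses_algebraic_hyperbolicSixfold)
    (hCM : Theses.RankFourFaces.CMAbelianHodge)
    (hK3Pdeg : HCOnClass fun A ↦
      ProdCMCell IsQuarticFieldTypeIVFourfold (fun Z ↦ Z.dim = 2) A ∧ ¬ IsStablyNondegenerate A)
    (hRW6 : WeilTypeLadder.NonsplitSixfolds)
    (hX2 : SixfoldCodimTwoCensus) (hX1 : SixfoldCodimThreeCensus) : HCAtDim 6 :=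
  hcAtDim_six_of_tableX_residues hMark₄ hMark₆ hCM (hodgeQuarticTypeIVFourfoldTimesCMSurface_of_degenerate hK3Pdeg) hRW6
    hX2 hX1

/-- **TABLE X COVER WITH THE CM BINDER NARROWED AND THE K3P BINDER NARROWED (dimension 6)** — the landed
`hcAtDim_six_of_tableX_cmSplit` (Markman₄, Markman₆, CM-splitness `hS`, HC for the non-simple CM sixfolds, R-W6, X2, X1) with
`hK3P` replaced by HC on the DEGENERATE members of the K3-partner cell. None of the hypotheses is asserted; `HC_CM` is NOT proved.
[cite: MoonenZarhin1999LowDim, Thms. 0.1–0.2, §5] [cite: Markman2025SecantWeil, Thm. 1.5.1 (preprint, unrefereed)]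
[claim: Markman2025SurveySecant, status: under-review] [cite: vanGeemen1994HodgeAV, Lemma 5.2, §2.4 and (5.4.1)] -/
theorem hcAtDim_six_of_tableX_cmSplit_k3pDegenerate (hMark₄ : Markman2025_weilClasses_algebraic_abelianFourfold)
    (hMark₆ : Markman2025_weilClasses_algebraic_hyperbolicSixfold)
    (hS : ∀ (A : AbelianVariety ℂ) (φ : A ⟶ A) (d : ℕ), IsSimpleCMSixfold A → IsWeilType A φ 3 d →
      ∃ (e : ProjectiveEmbedding A.X) (a : complexBetti (projectiveSpace e.n ℂ) 2),
        IsRationalClass a ∧ a ≠ 0 ∧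
          HasWeilDiscriminantNondeg A φ 3 d
            ((d : ℂ) • complexBetti.map e.ι 2 a + complexBetti.map φ.hom.hom.hom 2 (complexBetti.map e.ι 2 a))
            (splitDiscriminantClass 3 d))
    (hCMns : HCOnClass fun A ↦ A.dim = 6 ∧ IsOfCMType A ∧ ¬ A.IsSimple)
    (hK3Pdeg : HCOnClass fun A ↦
      ProdCMCell IsQuarticFieldTypeIVFourfold (fun Z ↦ Z.dim = 2) A ∧ ¬ IsStablyNondegenerate A)
    (hRW6 : WeilTypeLadder.NonsplitSixfolds)
    (hX2 : SixfoldCodimTwoCensus) (hX1 : SixfoldCodimThreeCensus) : HCAtDim 6 :=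
  hcAtDim_six_of_tableX_cmSplit hMark₄ hMark₆ hS hCMns (hodgeQuarticTypeIVFourfoldTimesCMSurface_of_degenerate hK3Pdeg) hRW6
    hX2 hX1

/-! ## §3 The non-aligned row-25 members lie OUTSIDE the narrowed K3P class -/

section Row25

variable {Y S : AbelianVariety ℂ} {φY : Y ⟶ Y} {μ₁ μ₂ : ℂ}
  {K : Type} [Field K] [NumberField K] [IsCMField K] {Φ : CMType K} {ιS : 𝓞 K →+* End S}
  {θ : K →+* Module.End ℂ (complexBetti S.X 1)}

/-- **TABLE X row 25 has LEFT the residue (kernel certificate):** every `A ∼ S × Y` with `Y` a simple fourfold of quartic CM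
centre and signature `{(2,0),(1,1)}` (R10's class), `S` a simple CM surface of type `(K, Φ)`, and the member datum hNA (no
non-zero purely imaginary number in `ℚ(μ₂) ∩ K*_Φ`) is NOT in the narrowed K3P class — it is stably nondegenerate
(`TableX.ProductRows.isStablyNondegenerate_row25_of_notAligned`). [cite: MoonenZarhin1999LowDim, §3 Thm. (3.2), Lemma (3.6) and §5 Case 2]
[cite: vanGeemen1994HodgeAV, §2.4 and §3.6] -/
theorem not_k3pDegenerate_of_row25_notAligned {A : AbelianVariety ℂ} (hYs : Y.IsSimple)
    (hE4 : Module.finrank ℚ Y.endAlgebra = 4) (h11 : starRingEnd ℂ μ₁ ≠ μ₁) (h22 : starRingEnd ℂ μ₂ ≠ μ₂) (h12 : μ₂ ≠ μ₁)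
    (h12' : μ₂ ≠ starRingEnd ℂ μ₁) (h1 : eigenMultiplicity Y φY μ₁ = 1)
    (h1' : eigenMultiplicity Y φY (starRingEnd ℂ μ₁) = 1) (h2 : eigenMultiplicity Y φY μ₂ = 2) (hY4 : Y.dim = 4)
    (hreal : IsCMTypeRealisation Φ S ιS θ) (hK4 : Module.finrank ℚ K = 4) (hSs : S.IsSimple)
    (hNA : ∀ w : ℂ, w ∈ IntermediateField.adjoin ℚ {μ₂} → w ∈ traceField Φ → starRingEnd ℂ w = -w → w = 0)
    (hA : IsIsogenous A (S.prod Y)) :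
    ¬ (ProdCMCell IsQuarticFieldTypeIVFourfold (fun Z ↦ Z.dim = 2) A ∧ ¬ IsStablyNondegenerate A) := fun h ↦
  h.2 (ProductRows.isStablyNondegenerate_row25_of_notAligned hYs hE4 h11 h22 h12 h12' h1 h1' h2 hY4 hreal hK4 hSs hNA hA)

/-- **Row 25a («samefield») has left the residue, no datum**: `K` non-normal quartic CM with an embedding onto `ℚ(μ₂)`
(`TableX.ProductRows.isStablyNondegenerate_row25_sameField`; Shimura §8.4 (2)(C)). [cite: Shimura1998, §8.4 Example (2)(C)]
[cite: MoonenZarhin1999LowDim, §3 Thm. (3.2) and §5 Case 2] -/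
theorem not_k3pDegenerate_of_row25_sameField {A : AbelianVariety ℂ} (hYs : Y.IsSimple)
    (hE4 : Module.finrank ℚ Y.endAlgebra = 4) (h11 : starRingEnd ℂ μ₁ ≠ μ₁) (h22 : starRingEnd ℂ μ₂ ≠ μ₂) (h12 : μ₂ ≠ μ₁)
    (h12' : μ₂ ≠ starRingEnd ℂ μ₁) (h1 : eigenMultiplicity Y φY μ₁ = 1)
    (h1' : eigenMultiplicity Y φY (starRingEnd ℂ μ₁) = 1) (h2 : eigenMultiplicity Y φY μ₂ = 2) (hY4 : Y.dim = 4)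
    (hreal : IsCMTypeRealisation Φ S ιS θ) (hK4 : Module.finrank ℚ K = 4) (hSs : S.IsSimple) (hKg : ¬ IsGalois ℚ K)
    (z : K →+* ℂ) (hz : z.toRatAlgHom.fieldRange = IntermediateField.adjoin ℚ {μ₂})
    (hA : IsIsogenous A (S.prod Y)) :
    ¬ (ProdCMCell IsQuarticFieldTypeIVFourfold (fun Z ↦ Z.dim = 2) A ∧ ¬ IsStablyNondegenerate A) := fun h ↦
  h.2 (ProductRows.isStablyNondegenerate_row25_sameField hYs hE4 h11 h22 h12 h12' h1 h1' h2 hY4 hreal hK4 hSs hKg z hz hA)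

/-- **Row 25 with `E = ℚ(μ₂)` biquadratic (member data `h4μ`, `hbq`) and `S` simple has left the residue, no datum**
(`TableX.ProductRows.isStablyNondegenerate_row25_biquadraticCentre`, over eng-4 g9's `QuarticCM.forall_eq_zero_of_biquadratic`).
[cite: Shimura1998, §8.4 Example (2)] [cite: MoonenZarhin1999LowDim, §3 Thm. (3.2) and §5 Case 2] -/
theorem not_k3pDegenerate_of_row25_biquadraticCentre {A : AbelianVariety ℂ} (hYs : Y.IsSimple)
    (hE4 : Module.finrank ℚ Y.endAlgebra = 4) (h11 : starRingEnd ℂ μ₁ ≠ μ₁) (h22 : starRingEnd ℂ μ₂ ≠ μ₂) (h12 : μ₂ ≠ μ₁)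
    (h12' : μ₂ ≠ starRingEnd ℂ μ₁) (h1 : eigenMultiplicity Y φY μ₁ = 1)
    (h1' : eigenMultiplicity Y φY (starRingEnd ℂ μ₁) = 1) (h2 : eigenMultiplicity Y φY μ₂ = 2) (hY4 : Y.dim = 4)
    (hreal : IsCMTypeRealisation Φ S ιS θ) (hK4 : Module.finrank ℚ K = 4) (hSs : S.IsSimple)
    (h4μ : Module.finrank ℚ (IntermediateField.adjoin ℚ {μ₂}) = 4)
    (hbq : ∃ ϑ ∈ IntermediateField.adjoin ℚ {μ₂}, ∃ q : ℚ, q < 0 ∧ ϑ ^ 2 = (q : ℂ))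
    (hA : IsIsogenous A (S.prod Y)) :
    ¬ (ProdCMCell IsQuarticFieldTypeIVFourfold (fun Z ↦ Z.dim = 2) A ∧ ¬ IsStablyNondegenerate A) := fun h ↦
  h.2 (ProductRows.isStablyNondegenerate_row25_biquadraticCentre hYs hE4 h11 h22 h12 h12' h1 h1' h2 hY4 hreal hK4 hSs h4μ
    hbq hA)

end Row25

/-! ## §4 Audit: nothing lost, on path -/

/-- **Nothing lost**: the landed K3P binder gives the narrowed one, so the narrowed covers imply the landed ones' conclusions
under the landed hypotheses. [folklore] -/
theorem hK3Pdeg_of_hK3P (hK3P : HodgeQuarticTypeIVFourfoldTimesCMSurface) :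
    HCOnClass fun A ↦ ProdCMCell IsQuarticFieldTypeIVFourfold (fun Z ↦ Z.dim = 2) A ∧ ¬ IsStablyNondegenerate A :=
  hcOnClass_and_not_isStablyNondegenerate_of_hcOnClass hK3P

/- Audit (on path): the narrowed K3P class target is a case of the summit (`hcOnClass_of_hodgeConjecture`). -/
example (h : _root_.HodgeConjecture) :
    HCOnClass fun A ↦ ProdCMCell IsQuarticFieldTypeIVFourfold (fun Z ↦ Z.dim = 2) A ∧ ¬ IsStablyNondegenerate A :=
  hcOnClass_of_hodgeConjecture _ h

end Summit.HodgeConjecture.HodgeConjecture.TableX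

end
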